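import Literature.MathematicalPhysics.QuantumFieldTheory.Balaban1983to89.B9Eq316AveragingTransposeZdPrinted
import Literature.MathematicalPhysics.QuantumFieldTheory.Balaban1983to89.B9Ineq3137LocalSup

/-!
# `Balaban1983to89.B9Eq316AveragingTransposeZdLinear` — [Balaban1985BackgroundPropagators] (3.16) p. 393, companion of
# `B9Eq316AveragingTransposeZd` ∕ `…Printed`: THE GENUINE AVERAGING LETTER `Q*aQ` IS ℝ-LINEAR IN THE FIELD — `QQZdP … U₀ (A + A′) =
# QQZdP … A + QQZdP … A′`, `QQZdP … (r•A) = r•QQZdP … A` (and the same for v1.0's `QQZd`), at every unitary background, for ALL bond fields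

statement-level skeleton of published theorems with citation tags; proofs where landed; nothing here is a claim about the
Yang–Mills mass gap

`[Balaban1985BackgroundPropagators]` ("B9", CMP **99** (1985) 389–434) p. 393: (3.16) defines `Q*aQ` «by the quadratic form» — a LINEAR operator
(p. 392 «we will consider operators»); `[Balaban1985Averaging]` ("B7" = B9's [5]) Prop. 3 (121)–(122) p. 36: the one-step map `Q(V₀, ·)` has a
LINEAR part `L(Q(V₀)A)_c` at regular backgrounds (the tree: `B7Prop3GeneralTild.linQcov_add ∕ _smul`, `B7Prop5GeneralLevels.hadd_levels ∕ hsmul_levels`,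
`B7Prop5GeneralLinear.linCovIter_line`); `[Balaban1985RegularSpaces]` ("B8") (1.7) p. 77, (1.31) p. 82.

CITATION HEADER (lean-in-tree rule).  Cell `pub-ymgap`, DAG node N06 = [B9], seat `pub-ymgap-dag-n06-b` gen 17 (owner of the letter `QQZd`∕`QQZdP`,
p595278 ∕ p596576).  WHY THIS FILE: dag-n06-w4 g2's four-letter record `opsAllZd τ L ΛbP ops₀ := withGopZd (opsLandau τ (withDpZd (withQQ(P) τ L ΛbP ops₀)))`
(INTENT-4, cell bus 2026-08-28T02:11Z) needs the averaging letter to be ℝ-LINEAR in `A` (its `QQLinearInClassAt`), asked BY NAME from the letter's owner.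
Print's `Q*aQ` is linear by definition; the tree's letter is a sum of fibre-transposed columns of the composite averaging applied to `𝟙_{Λ_j}LʲηQ_j(U₀)A`,
guarded by the class (1.7): ON the class each class bond's box lies in the regularity domain, where [5] (122) makes `LʲQ_j(U₀)` additive and homogeneous
(at the clamped background, transported by locality `B9Ineq3137LocalSup.linCovIter_congr`), and the transpose `entryT` is linear in its vector argument
for ANY column map; OFF the class the letter is `0`.  REUSED BY NAME: everything of the two companions; `B9Ineq3137LocalSup.linCovIter_congr` (public
locality); `B7Prop1Local.clampCfg` family; `B7Prop5GeneralLevels.hadd_levels ∕ hsmul_levels`; `B7Prop5GeneralLinear.linCovIter_line`.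

WHAT IS PROVED (kernel, 0 sorry; theorems only, no `def`).
* §1 `entryT_add'` ∕ `entryT_smul` (the fibre transpose `Eᵀ` is additive ∕ real-homogeneous in its vector argument, for EVERY map `E`) ·
  `linCovIterT_add` ∕ `linCovIterT_smul` (the transposed composite `Q_jᵀ` is additive ∕ real-homogeneous in the bond field `B`, at every background).
* §2 `linCovIter_add_of_reg17` ∕ `linCovIter_smul_of_reg17` — [5] (122) AT A CLASS BOND: for unitary `U₀ ∈ Reg17 L m Ω α` (`α ≤ α_Q`), `j ≤ m`, a level-`j` bond whose
  box lies in `Ω_j`, and ALL fields `B, B′`, `t : ℂ`: `LʲQ_j(U₀)(B + B′)(c) = LʲQ_j(U₀)B(c) + LʲQ_j(U₀)B′(c)`, `LʲQ_j(U₀)(t•B)(c) = t•LʲQ_j(U₀)B(c)` ·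
  `clsField_add_of_reg17` ∕ `clsField_smul_of_reg17` (`𝟙_{Λ_j}LʲηQ_j(U₀)·` is additive ∕ real-homogeneous in `A` when every class box lies in the regularity domain).
* §3 ★ `QQZdP_add` ∕ ★ `QQZdP_smul_real` — EDITION P's letter: for `L ≥ 2`, unitary `U₀`, a class with «box of a level-`j` class bond ⊂ Ω_{j−1}» (`j ≤ m`),
  and ALL fields: `QQZdP τ L ΛbP i m U₀ (A + A′) = QQZdP … A + QQZdP … A′`, `QQZdP … (r • A) = r • QQZdP … A` (`r : ℝ`) ·
  `QQZd_add` ∕ `QQZd_smul_real` — the same for v1.0's `QQZd` under «box ⊂ Ω_j».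
HONEST SCOPE.  Algebra of the landed letter (no estimate); the regime guard makes the OFF-class branch the zero map (linear trivially); hypotheses are the
class's BOX clause only (no collar clause, no faithfulness of `τ`); count-neutral helper of K1⁷; N05∕N06 NOT discharged; nothing continuum ∕ `ℝ⁴` ∕ OS ∕
mass-gap ∕ Clay.  Unit `pub-ymgap-dag-n06-b` (g17), 2026-08-28.
-/

noncomputable section

open scoped BigOperators
open NormedSpace

namespace Literature.MathematicalPhysics.QuantumFieldTheory.Balaban1983to89.B9Eq316AveragingTransposeZdLinear

open B9Eq316AveragingTransposeZd B9Eq316AveragingTransposeZdPrinted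

-- `Site` alone could resolve to the torus sites of `Setup.lean`; re-export the `ℤ^d` sites of `B7Prop1Explicit`.
export B7Prop1Explicit (Site)

variable {d : ℕ} {𝔸 : Type*} [CStarAlgebra 𝔸]

/-! ## §1 Linearity of the fibre transpose and of `Q_jᵀ` in their vector ∕ field argument -/

section Fibre

open B7Prop5Flat (bump)
open B7Prop4GeneralLevels (linCovIter)

variable (τ : 𝔸 →ₗ[ℂ] ℂ) [FiniteDimensional ℝ 𝔸]

/-- **`Eᵀ` is additive in its vector argument** (for EVERY map `E`; public twin of the companion's private lemma). [cite: Balaban1985BackgroundPropagators, (3.16) p.393 («an operator Q*aQ»)] -/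
theorem entryT_add' (E : 𝔸 → 𝔸) (v w : 𝔸) : entryT τ E (v + w) = entryT τ E v + entryT τ E w := by
  unfold entryT
  split_ifs
  · rw [← Finset.sum_add_distrib]
    refine Finset.sum_congr rfl fun i _ => ?_
    rw [map_add, LinearMap.add_apply, add_smul]
  · rw [add_zero]

/-- **`Eᵀ` is real-homogeneous in its vector argument** (for EVERY map `E`). [cite: Balaban1985BackgroundPropagators, (3.16) p.393 («an operator Q*aQ»)] -/
theorem entryT_smul (E : 𝔸 → 𝔸) (r : ℝ) (v : 𝔸) : entryT τ E (r • v) = r • entryT τ E v := by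
  unfold entryT
  split_ifs
  · rw [Finset.smul_sum]
    refine Finset.sum_congr rfl fun i _ => ?_
    rw [map_smul, LinearMap.smul_apply, smul_eq_mul, ← smul_smul]
  · rw [smul_zero]

/-- **`Q_jᵀ` is additive in the bond field** (every background). [cite: Balaban1985BackgroundPropagators, (3.16) p.393; Balaban1985Averaging, (127) p.37] -/
theorem linCovIterT_add (L : ℕ) (U₀ : Site d → Fin d → 𝔸ˣ) (j : ℕ) (B B' : Site d → Fin d → 𝔸) (y : Site d) (μ : Fin d) :
    linCovIterT τ L U₀ j (B + B') y μ = linCovIterT τ L U₀ j B y μ + linCovIterT τ L U₀ j B' y μ := by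
  unfold linCovIterT
  rw [← Finset.sum_add_distrib]
  refine Finset.sum_congr rfl fun κ _ => ?_
  rw [← Finset.sum_add_distrib]
  refine Finset.sum_congr rfl fun t _ => ?_
  rw [Pi.add_apply, Pi.add_apply, entryT_add']

/-- **`Q_jᵀ` is real-homogeneous in the bond field** (every background). [cite: Balaban1985BackgroundPropagators, (3.16) p.393; Balaban1985Averaging, (127) p.37] -/
theorem linCovIterT_smul (L : ℕ) (U₀ : Site d → Fin d → 𝔸ˣ) (j : ℕ) (r : ℝ) (B : Site d → Fin d → 𝔸) (y : Site d) (μ : Fin d) :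
    linCovIterT τ L U₀ j (r • B) y μ = r • linCovIterT τ L U₀ j B y μ := by
  unfold linCovIterT
  rw [Finset.smul_sum]
  refine Finset.sum_congr rfl fun κ _ => ?_
  rw [Finset.smul_sum]
  refine Finset.sum_congr rfl fun t _ => ?_
  rw [Pi.smul_apply, Pi.smul_apply, entryT_smul]

end Fibre

/-! ## §2 [5] (122) at a class bond: the composite averaging is additive and homogeneous in the field on the class (1.7) -/

section Regime

open B7Prop1Explicit (U1 e)
open B7Prop1Local (InBox AgreeOn loK bondHiK clampCfg clampCfg_agree clampCfg_mem pdev_clampCfg_le)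
open B7Prop2Explicit (pdev C0 c2' C0_pos unitaryUnits avgClosed_unitaryUnits)
open B7Prop5Flat (bump)
open B7Prop3GeneralLinear (linQcov)
open B7Prop4GeneralLevels (linCovIter linCovIter_succ)
open B7Prop5GeneralLevels (hadd_levels hsmul_levels)
open B7Prop5GeneralLinear (linCovIter_line)
open B8Ineq132 (plaqF pdevOn_lt_of_forall PlaqTouches)
open B8Eq146AExpansion (iEta)

variable [Nontrivial 𝔸]

omit [Nontrivial 𝔸] in
/-- `LʲηQ_j(U₀)0 = 0` (private copy). [cite: Balaban1985Averaging, (127) p.37] -/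
private theorem linCovIter_zero_fun (L : ℕ) (U₀ : Site d → Fin d → 𝔸ˣ) : ∀ j : ℕ, linCovIter L U₀ (0 : Site d → Fin d → 𝔸) j = 0
  | 0 => rfl
  | j + 1 => by
    funext z κ
    rw [linCovIter_succ, linCovIter_zero_fun L U₀ j]
    simp [linQcov]

omit [CStarAlgebra 𝔸] [Nontrivial 𝔸] in
/-- the box is a genuine box (private copy). [folklore] -/
private theorem loK_le_bondHiK {L : ℕ} (hL : 1 ≤ L) (j : ℕ) (z : Site d) (κ : Fin d) (i : Fin d) :
    loK L j z i ≤ bondHiK L j z κ i := by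
  have hP : (1 : ℤ) ≤ (L : ℤ) ^ j := one_le_pow₀ (by exact_mod_cast hL)
  simp only [loK, bondHiK]
  split_ifs <;> omega

/-- the clamped extension of a class-(1.7) background at a bond whose box lies in `Ω_j` (private copy of the companion's `clamp_data`).
[cite: Balaban1985Averaging, p.24 (locality), Prop. 1 (51) p.26; Balaban1985RegularSpaces, (1.7) p.77] -/
private theorem clamp_data {L : ℕ} (hL : 1 ≤ L) {m : ℕ} {Ω : ℕ → Set (Site d)} {α : ℝ} (hα : 0 < α)
    {U₀ : Site d → Fin d → 𝔸ˣ} (hU₀ : ∀ x κ, U₀ x κ ∈ unitaryUnits 𝔸) (hreg : Reg17 L m Ω α U₀)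
    {j : ℕ} (hj : j ≤ m) (z : Site d) (κ : Fin d) (hbox : ∀ x, InBox (loK L j z) (bondHiK L j z κ) x → x ∈ Ω j) :
    (∀ x ν, clampCfg (loK L j z) (bondHiK L j z κ) U₀ x ν ∈ unitaryUnits 𝔸) ∧
      pdev (clampCfg (loK L j z) (bondHiK L j z κ) U₀) < α * (((L : ℝ) ^ j)⁻¹) ^ 2 ∧
      AgreeOn (loK L j z) (bondHiK L j z κ) (clampCfg (loK L j z) (bondHiK L j z κ) U₀) U₀ := by
  have hU₀U1 : ∀ x μ, U₀ x μ ∈ U1 𝔸 := fun x μ => (avgClosed_unitaryUnits d L).le_U1 (hU₀ x μ)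
  have hL0 : (0 : ℝ) < L := by exact_mod_cast hL
  refine ⟨clampCfg_mem hU₀, ?_, clampCfg_agree U₀⟩
  have hpdOn : B7Prop1Local.pdevOn (loK L j z) (bondHiK L j z κ) U₀ < α * (((L : ℝ) ^ j)⁻¹) ^ 2 := by
    refine pdevOn_lt_of_forall (by positivity) fun x μ ν hx hx' => ?_
    rcases eq_or_ne μ ν with rfl | hμν
    · rw [B7Prop2Explicit.hol_plaqWord_self, Units.val_one, sub_self, norm_zero]; positivity
    · exact hreg j hj x μ ν hμν (Or.inl (hbox x hx))
  exact (pdev_clampCfg_le (loK_le_bondHiK hL j z κ) hU₀U1).trans_lt hpdOn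

/-- ★ **[5] (122) AT A CLASS BOND — ADDITIVITY IN THE FIELD**: for a unitary `U₀` in the class (1.7) up to level `m` (`α ≤ α_Q`), a level-`j` bond
(`j ≤ m`) whose box lies in `Ω_j`, and ALL bond fields `B, B′`: `LʲQ_j(U₀)(B + B′)(c) = LʲQ_j(U₀)B(c) + LʲQ_j(U₀)B′(c)` («Q(V₀, A, c) = L(Q(V₀)A)_c + C»,
the linear part IS linear at regular `V₀` — `hadd_levels` at the clamped extension, transported by locality). [cite: Balaban1985Averaging, (122) p.36, p.38 (before (133)), p.24; Balaban1985RegularSpaces, (1.7) p.77] -/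
theorem linCovIter_add_of_reg17 {L : ℕ} (hL : 2 ≤ L) {m : ℕ} {Ω : ℕ → Set (Site d)} {α : ℝ} (hα : 0 < α)
    (hαQ : α ≤ alphaQ d L) {U₀ : Site d → Fin d → 𝔸ˣ} (hU₀ : ∀ x κ, U₀ x κ ∈ unitaryUnits 𝔸) (hreg : Reg17 L m Ω α U₀)
    {j : ℕ} (hj : j ≤ m) (z : Site d) (κ : Fin d) (hbox : ∀ x, InBox (loK L j z) (bondHiK L j z κ) x → x ∈ Ω j)
    (B B' : Site d → Fin d → 𝔸) :
    linCovIter L U₀ (B + B') j z κ = linCovIter L U₀ B j z κ + linCovIter L U₀ B' j z κ := by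
  have hL1 : 1 ≤ L := le_trans (by norm_num) hL
  obtain ⟨hUG, hpdev, hag⟩ := clamp_data hL1 hα hU₀ hreg hj z κ hbox
  have hα3 : C0 d * α ≤ 1 / 3 := (mul_le_mul_of_nonneg_left hαQ (C0_pos d).le).trans (C0_mul_alphaQ_le d L)
  have hα4 : 4 * α ≤ c2' d L := by linarith [four_mul_alphaQ_le d L]
  set U' := clampCfg (loK L j z) (bondHiK L j z κ) U₀ with hU'
  have htr : ∀ F : Site d → Fin d → 𝔸, linCovIter L U₀ F j z κ = linCovIter L U' F j z κ :=
    fun F => B9Ineq3137LocalSup.linCovIter_congr L hL1 j z κ hag.symm (fun _ _ _ _ => rfl)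
  have h := linCovIter_line L U' j (hadd_levels L hL (avgClosed_unitaryUnits d L) j U' hUG hα hα3 hα4 hpdev)
    (hsmul_levels L hL (avgClosed_unitaryUnits d L) j U' hUG hα hα3 hα4 hpdev) B B' j le_rfl (1 : ℂ) z κ
  rw [one_smul, one_smul] at h
  rw [htr, htr B, htr B', h]

/-- ★ **[5] (122) AT A CLASS BOND — HOMOGENEITY IN THE FIELD** (complex scalars): `LʲQ_j(U₀)(t•B)(c) = t•LʲQ_j(U₀)B(c)` under the hypotheses of
`linCovIter_add_of_reg17`. [cite: Balaban1985Averaging, (122) p.36, p.38 (before (133)), p.24; Balaban1985RegularSpaces, (1.7) p.77] -/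
theorem linCovIter_smul_of_reg17 {L : ℕ} (hL : 2 ≤ L) {m : ℕ} {Ω : ℕ → Set (Site d)} {α : ℝ} (hα : 0 < α)
    (hαQ : α ≤ alphaQ d L) {U₀ : Site d → Fin d → 𝔸ˣ} (hU₀ : ∀ x κ, U₀ x κ ∈ unitaryUnits 𝔸) (hreg : Reg17 L m Ω α U₀)
    {j : ℕ} (hj : j ≤ m) (z : Site d) (κ : Fin d) (hbox : ∀ x, InBox (loK L j z) (bondHiK L j z κ) x → x ∈ Ω j)
    (t : ℂ) (B : Site d → Fin d → 𝔸) :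
    linCovIter L U₀ (t • B) j z κ = t • linCovIter L U₀ B j z κ := by
  have hL1 : 1 ≤ L := le_trans (by norm_num) hL
  obtain ⟨hUG, hpdev, hag⟩ := clamp_data hL1 hα hU₀ hreg hj z κ hbox
  have hα3 : C0 d * α ≤ 1 / 3 := (mul_le_mul_of_nonneg_left hαQ (C0_pos d).le).trans (C0_mul_alphaQ_le d L)
  have hα4 : 4 * α ≤ c2' d L := by linarith [four_mul_alphaQ_le d L]
  set U' := clampCfg (loK L j z) (bondHiK L j z κ) U₀ with hU'
  have htr : ∀ F : Site d → Fin d → 𝔸, linCovIter L U₀ F j z κ = linCovIter L U' F j z κ :=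
    fun F => B9Ineq3137LocalSup.linCovIter_congr L hL1 j z κ hag.symm (fun _ _ _ _ => rfl)
  have h := linCovIter_line L U' j (hadd_levels L hL (avgClosed_unitaryUnits d L) j U' hUG hα hα3 hα4 hpdev)
    (hsmul_levels L hL (avgClosed_unitaryUnits d L) j U' hUG hα hα3 hα4 hpdev) 0 B j le_rfl t z κ
  rw [zero_add, linCovIter_zero_fun, Pi.zero_apply, Pi.zero_apply, zero_add] at h
  rw [htr, htr B, h]

omit [Nontrivial 𝔸] in
/-- `iη(A + A′) = iηA + iηA′`. [cite: Balaban1985RegularSpaces, (1.41) p.83 (the exponent variable `iηA`)] -/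
private theorem iEta_add (η : ℝ) (A A' : Site d → Fin d → 𝔸) : iEta η (A + A') = iEta η A + iEta η A' := by
  funext y κ; simp [iEta, smul_add]

omit [Nontrivial 𝔸] in
/-- `iη(r•A) = (r : ℂ)•iηA` for real `r`. [cite: Balaban1985RegularSpaces, (1.41) p.83 (the exponent variable `iηA`)] -/
private theorem iEta_smul (η : ℝ) (r : ℝ) (A : Site d → Fin d → 𝔸) : iEta η (r • A) = (r : ℂ) • iEta η A := by
  funext y κ
  simp only [iEta, Pi.smul_apply]
  rw [← Complex.coe_smul, smul_comm]

/-- ★ **`𝟙_{Λ_j}·(−i)·LʲQ_j(U₀)(iη·)` IS ADDITIVE IN `A`** when every box of a level-`j` class bond lies in the regularity domain `Ω_j` of the class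
(1.7) read at window `α ≤ α_Q`. [cite: Balaban1985BackgroundPropagators, (3.16) p.393; Balaban1985Averaging, (122) p.36] -/
theorem clsField_add_of_reg17 {L : ℕ} (hL : 2 ≤ L) {m : ℕ} {Ω : ℕ → Set (Site d)} {α : ℝ} (hα : 0 < α)
    (hαQ : α ≤ alphaQ d L) {U₀ : Site d → Fin d → 𝔸ˣ} (hU₀ : ∀ x κ, U₀ x κ ∈ unitaryUnits 𝔸) (hreg : Reg17 L m Ω α U₀)
    (ΛbP : ℕ → ℕ → Set (Site d × Fin d)) {j : ℕ} (hj : j ≤ m)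
    (hbox : ∀ c ∈ ΛbP m j, ∀ x, InBox (loK L j c.1) (bondHiK L j c.1 c.2) x → x ∈ Ω j)
    (η : ℝ) (A A' : Site d → Fin d → 𝔸) :
    clsField L ΛbP η m j U₀ (A + A') = clsField L ΛbP η m j U₀ A + clsField L ΛbP η m j U₀ A' := by
  classical
  funext z κ
  simp only [clsField, Pi.add_apply]
  split_ifs with hc
  · rw [iEta_add, linCovIter_add_of_reg17 hL hα hαQ hU₀ hreg hj z κ (hbox (z, κ) hc), smul_add]
  · rw [add_zero]

/-- ★ **`𝟙_{Λ_j}·(−i)·LʲQ_j(U₀)(iη·)` IS REAL-HOMOGENEOUS IN `A`** (same hypotheses). [cite: Balaban1985BackgroundPropagators, (3.16) p.393; Balaban1985Averaging, (122) p.36] -/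
theorem clsField_smul_of_reg17 {L : ℕ} (hL : 2 ≤ L) {m : ℕ} {Ω : ℕ → Set (Site d)} {α : ℝ} (hα : 0 < α)
    (hαQ : α ≤ alphaQ d L) {U₀ : Site d → Fin d → 𝔸ˣ} (hU₀ : ∀ x κ, U₀ x κ ∈ unitaryUnits 𝔸) (hreg : Reg17 L m Ω α U₀)
    (ΛbP : ℕ → ℕ → Set (Site d × Fin d)) {j : ℕ} (hj : j ≤ m)
    (hbox : ∀ c ∈ ΛbP m j, ∀ x, InBox (loK L j c.1) (bondHiK L j c.1 c.2) x → x ∈ Ω j)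
    (η : ℝ) (r : ℝ) (A : Site d → Fin d → 𝔸) :
    clsField L ΛbP η m j U₀ (r • A) = r • clsField L ΛbP η m j U₀ A := by
  classical
  funext z κ
  simp only [clsField, Pi.smul_apply]
  split_ifs with hc
  · rw [iEta_smul, linCovIter_smul_of_reg17 hL hα hαQ hU₀ hreg hj z κ (hbox (z, κ) hc), smul_comm, Complex.coe_smul]
  · rw [smul_zero]

end Regime

/-! ## §3 The letters `QQZdP` (edition P) and `QQZd` (v1.0) are ℝ-linear in the field -/

section Letter

open B7Prop1Local (InBox loK bondHiK)
open B7Prop2Explicit (unitaryUnits)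
open B8LeafModelZd (ZdIdx)

variable (τ : 𝔸 →ₗ[ℂ] ℂ) [FiniteDimensional ℝ 𝔸] (L : ℕ) [Nontrivial 𝔸]

/-- ★ **EDITION P's LETTER IS ADDITIVE IN THE FIELD**: for `L ≥ 2`, unitary `U₀`, a class whose level-`j` bonds (`j ≤ m`) have their box in `Ω_{j−1}`
(print's (1.31) box law), and ALL fields `A, A′`: `QQZdP τ L ΛbP i m U₀ (A + A′) = QQZdP … A + QQZdP … A′` — ON the class (1.7) (window `α_Q∕L²`, read
one level up by `reg17_shift`) by §1–§2, OFF it `0 = 0 + 0`. [cite: Balaban1985BackgroundPropagators, (3.16) p.393 («we define an operator Q*aQ»); Balaban1985Averaging, (122) p.36; Balaban1985RegularSpaces, (1.7) p.77, (1.31) p.82] -/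
theorem QQZdP_add (hL : 2 ≤ L) {ΛbP : ℕ → ℕ → Set (Site d × Fin d)} {i : ZdIdx d L} {m : ℕ}
    (hbox : ∀ j, j ≤ m → ∀ c ∈ ΛbP m j, ∀ x, InBox (loK L j c.1) (bondHiK L j c.1 c.2) x → x ∈ i.Ω (j - 1))
    {U₀ : Site d → Fin d → 𝔸ˣ} (hU₀ : ∀ x κ, U₀ x κ ∈ unitaryUnits 𝔸) (A A' : Site d → Fin d → 𝔸) :
    QQZdP τ L ΛbP i m U₀ (A + A') = QQZdP τ L ΛbP i m U₀ A + QQZdP τ L ΛbP i m U₀ A' := by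
  have hL1 : 1 ≤ L := le_trans (by norm_num) hL
  have hL0 : (0 : ℝ) < L := by exact_mod_cast (lt_of_lt_of_le (by norm_num) hL)
  funext y μ
  simp only [Pi.add_apply]
  by_cases hreg : Reg17 L m i.Ω (alphaQ d L / (L : ℝ) ^ 2) U₀
  · have hreg' : Reg17 L m (fun j => i.Ω (j - 1)) (alphaQ d L) U₀ := by
      have h := reg17_shift hL1 hreg
      rwa [div_mul_cancel₀ _ (by positivity)] at h
    rw [QQZdP_of_reg17 τ L hreg, QQZdP_of_reg17 τ L hreg, QQZdP_of_reg17 τ L hreg, ← Finset.sum_add_distrib]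
    refine Finset.sum_congr rfl fun j hjm => ?_
    have hj : j ≤ m := by rw [Finset.mem_range] at hjm; omega
    rw [clsField_add_of_reg17 hL (alphaQ_pos d hL1) le_rfl hU₀ hreg' ΛbP hj (hbox j hj), linCovIterT_add, smul_add]
  · rw [QQZdP_of_not_reg17 τ L hreg, QQZdP_of_not_reg17 τ L hreg, QQZdP_of_not_reg17 τ L hreg, add_zero]

/-- ★ **EDITION P's LETTER IS REAL-HOMOGENEOUS IN THE FIELD** (same hypotheses): `QQZdP … (r • A) = r • QQZdP … A`. [cite: Balaban1985BackgroundPropagators, (3.16) p.393; Balaban1985Averaging, (122) p.36; Balaban1985RegularSpaces, (1.7) p.77, (1.31) p.82] -/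
theorem QQZdP_smul_real (hL : 2 ≤ L) {ΛbP : ℕ → ℕ → Set (Site d × Fin d)} {i : ZdIdx d L} {m : ℕ}
    (hbox : ∀ j, j ≤ m → ∀ c ∈ ΛbP m j, ∀ x, InBox (loK L j c.1) (bondHiK L j c.1 c.2) x → x ∈ i.Ω (j - 1))
    {U₀ : Site d → Fin d → 𝔸ˣ} (hU₀ : ∀ x κ, U₀ x κ ∈ unitaryUnits 𝔸) (r : ℝ) (A : Site d → Fin d → 𝔸) :
    QQZdP τ L ΛbP i m U₀ (r • A) = r • QQZdP τ L ΛbP i m U₀ A := by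
  have hL1 : 1 ≤ L := le_trans (by norm_num) hL
  have hL0 : (0 : ℝ) < L := by exact_mod_cast (lt_of_lt_of_le (by norm_num) hL)
  funext y μ
  simp only [Pi.smul_apply]
  by_cases hreg : Reg17 L m i.Ω (alphaQ d L / (L : ℝ) ^ 2) U₀
  · have hreg' : Reg17 L m (fun j => i.Ω (j - 1)) (alphaQ d L) U₀ := by
      have h := reg17_shift hL1 hreg
      rwa [div_mul_cancel₀ _ (by positivity)] at h
    rw [QQZdP_of_reg17 τ L hreg, QQZdP_of_reg17 τ L hreg, Finset.smul_sum]
    refine Finset.sum_congr rfl fun j hjm => ?_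
    have hj : j ≤ m := by rw [Finset.mem_range] at hjm; omega
    rw [clsField_smul_of_reg17 hL (alphaQ_pos d hL1) le_rfl hU₀ hreg' ΛbP hj (hbox j hj), linCovIterT_smul, smul_comm]
  · rw [QQZdP_of_not_reg17 τ L hreg, QQZdP_of_not_reg17 τ L hreg, smul_zero]

/-- **v1.0's LETTER IS ADDITIVE IN THE FIELD** (class law «box ⊂ Ω_j»). [cite: Balaban1985BackgroundPropagators, (3.16) p.393; Balaban1985Averaging, (122) p.36; Balaban1985RegularSpaces, (1.7) p.77] -/
theorem QQZd_add (hL : 2 ≤ L) {ΛbP : ℕ → ℕ → Set (Site d × Fin d)} {i : ZdIdx d L} {m : ℕ}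
    (hbox : ∀ j, j ≤ m → ∀ c ∈ ΛbP m j, ∀ x, InBox (loK L j c.1) (bondHiK L j c.1 c.2) x → x ∈ i.Ω j)
    {U₀ : Site d → Fin d → 𝔸ˣ} (hU₀ : ∀ x κ, U₀ x κ ∈ unitaryUnits 𝔸) (A A' : Site d → Fin d → 𝔸) :
    QQZd τ L ΛbP i m U₀ (A + A') = QQZd τ L ΛbP i m U₀ A + QQZd τ L ΛbP i m U₀ A' := by
  have hL1 : 1 ≤ L := le_trans (by norm_num) hL
  funext y μ
  simp only [Pi.add_apply]
  by_cases hreg : Reg17 L m i.Ω (alphaQ d L) U₀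
  · rw [QQZd_of_reg17 τ L hreg, QQZd_of_reg17 τ L hreg, QQZd_of_reg17 τ L hreg, ← Finset.sum_add_distrib]
    refine Finset.sum_congr rfl fun j hjm => ?_
    have hj : j ≤ m := by rw [Finset.mem_range] at hjm; omega
    rw [clsField_add_of_reg17 hL (alphaQ_pos d hL1) le_rfl hU₀ hreg ΛbP hj (hbox j hj), linCovIterT_add, smul_add]
  · rw [QQZd_of_not_reg17 τ L hreg, QQZd_of_not_reg17 τ L hreg, QQZd_of_not_reg17 τ L hreg, add_zero]

/-- **v1.0's LETTER IS REAL-HOMOGENEOUS IN THE FIELD** (class law «box ⊂ Ω_j»). [cite: Balaban1985BackgroundPropagators, (3.16) p.393; Balaban1985Averaging, (122) p.36; Balaban1985RegularSpaces, (1.7) p.77] -/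
theorem QQZd_smul_real (hL : 2 ≤ L) {ΛbP : ℕ → ℕ → Set (Site d × Fin d)} {i : ZdIdx d L} {m : ℕ}
    (hbox : ∀ j, j ≤ m → ∀ c ∈ ΛbP m j, ∀ x, InBox (loK L j c.1) (bondHiK L j c.1 c.2) x → x ∈ i.Ω j)
    {U₀ : Site d → Fin d → 𝔸ˣ} (hU₀ : ∀ x κ, U₀ x κ ∈ unitaryUnits 𝔸) (r : ℝ) (A : Site d → Fin d → 𝔸) :
    QQZd τ L ΛbP i m U₀ (r • A) = r • QQZd τ L ΛbP i m U₀ A := by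
  have hL1 : 1 ≤ L := le_trans (by norm_num) hL
  funext y μ
  simp only [Pi.smul_apply]
  by_cases hreg : Reg17 L m i.Ω (alphaQ d L) U₀
  · rw [QQZd_of_reg17 τ L hreg, QQZd_of_reg17 τ L hreg, Finset.smul_sum]
    refine Finset.sum_congr rfl fun j hjm => ?_
    have hj : j ≤ m := by rw [Finset.mem_range] at hjm; omega
    rw [clsField_smul_of_reg17 hL (alphaQ_pos d hL1) le_rfl hU₀ hreg ΛbP hj (hbox j hj), linCovIterT_smul, smul_comm]
  · rw [QQZd_of_not_reg17 τ L hreg, QQZd_of_not_reg17 τ L hreg, smul_zero]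

end Letter

end Literature.MathematicalPhysics.QuantumFieldTheory.Balaban1983to89.B9Eq316AveragingTransposeZdLinear

end
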